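import Summits.QuantumFields.YangMills.Theorems.BalabanUVNodesN21DilationHazard

/-!
# N21 (NE7c) · PARTIAL dilation with exterior variables and ANY density: the collar condition as block-radial
# non-collapse — (M1) for a block-homogeneous statistic, constant `3(d_b+1)∕(1−ρ)`, `d_b` = BLOCK dimension

R134 seat pub-ymgap-dag-n21-d (g8), node N21 = NE7c (single-run shell-weight bound, NOT PRINTED in [Bałaban 1983–89],
NOT proved), lane K3⁷ `SpineGivenEndpointR13SepCoPH` (stmt-QuantumFields-20544, `--kind proof --supports … --as helper`).
Part 18 of the comparison series; consumes part 16 (`…N21DilationHazard`: `volume_params_le`, `inv_pow_le_three`).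

WHAT THIS FILE IS.  Part 16 dilated ALL coordinates of `ℝ^ι` and took the density `e^{−A}`.  Here the configuration
space `ℝ^ι` carries a BLOCK `b ⊆ ι` (the slot's fluctuation variables) and EXTERIOR coordinates `ι ∖ b`; the dilation
`D_λ : x_i ↦ λx_i (i ∈ b), x_i ↦ x_i (i ∉ b)` acts on the block only (a linear map of determinant `λ^{#b}`, Mathlib
`Measure.map_linearMap_addHaar_eq_smul_addHaar`); the density `g` is ANY measurable function — `e^{−A}` times all the
cuts of the term, exterior ones included; the statistic `U` is BLOCK-HOMOGENEOUS (`U(D_λ x) = λ·U(x)`).  The one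
hypothesis is BLOCK-RADIAL NON-COLLAPSE OF THE FULL DENSITY on the shell: `g(x) ≤ g(D_λ x)` for `θ(1−ρ) ≤ U(x) < θ`,
`λ ∈ [1 − 1∕(#b+1), 1]` — it packages (ii) radial monotonicity of the action in the block variables AND (iii) the COLLAR
condition «no exterior cut drops when the block shrinks» (automatic when no exterior statistic reads the block's
variables; this is where print's enlarged-cube geometry enters — LOCATED, not asserted).  Conclusion
(`measure_shell_le_of_blockHomogeneous`, `slotAntiConcentration_restrict_of_blockHomogeneous`):
`ν{θ(1−ρ) ≤ U < θ} ≤ 3(#b+1)·ρ∕(1−ρ) · ν{U < θ}` and `SlotAntiConcentration (ν|{U<θ}) U θ ρ (3(#b+1)∕(1−ρ))` — the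
constant reads the BLOCK dimension only, however many exterior variables and cuts the term carries.

HONEST FRAMING.  [textbook] measure theory (Haar behaviour under an invertible linear map, Tonelli); 0 def, 0 sorry;
nothing of Bałaban's asserted; NE7c NOT PRINTED ∕ NOT proved; N21 NOT discharged; counts unmoved (typed 28∕28 ·
discharged 5∕27); count-neutral; one finite 𝕋⁴ at fixed ε — nothing about ℝ⁴ ∕ OS ∕ mass gap ∕ Clay.
-/

open MeasureTheory Set Function Module
open scoped ENNReal NNReal

namespace Summit.QuantumFields.YangMills.Theorems.N21PartialDilationHazard

open Literature.MathematicalPhysics.QuantumFieldTheory.Balaban1983to89.T4ShellMeasure (SlotAntiConcentration)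
open Summit.QuantumFields.YangMills.Theorems.N21DilationHazard (volume_params_le inv_pow_le_three)

variable {ι : Type*} [Fintype ι] [DecidableEq ι]

/-! ## §1 The partial dilation: a diagonal linear map of determinant `λ^{#b}` -/

/-- the partial dilation is the diagonal linear map `diag(λ on b, 1 off b)`. [textbook] -/
theorem partialDil_eq_toLin' (b : Finset ι) (l : ℝ) :
    (fun x : ι → ℝ => fun i => (if i ∈ b then l else 1) * x i)
      = ⇑(Matrix.toLin' (Matrix.diagonal fun i => if i ∈ b then l else (1 : ℝ))) := by
  funext x i
  rw [Matrix.toLin'_apply, Matrix.mulVec_diagonal]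

/-- its determinant is `λ^{#b}`. [textbook] -/
theorem det_partialDil (b : Finset ι) (l : ℝ) :
    LinearMap.det (Matrix.toLin' (Matrix.diagonal fun i => if i ∈ b then l else (1 : ℝ))) = l ^ b.card := by
  rw [LinearMap.det_toLin', Matrix.det_diagonal, Finset.prod_ite_mem, Finset.univ_inter, Finset.prod_const]

omit [Fintype ι] in
/-- the partial dilation is measurable. [textbook] -/
theorem measurable_partialDil (b : Finset ι) (l : ℝ) :
    Measurable (fun x : ι → ℝ => fun i => (if i ∈ b then l else 1) * x i) :=
  measurable_pi_lambda _ fun i => (measurable_pi_apply i).const_mul _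

/-- **HAAR UNDER THE PARTIAL DILATION**: `map D_λ volume = |λ^{#b}|⁻¹ · volume` (`λ ≠ 0`). [textbook] -/
theorem map_volume_partialDil (b : Finset ι) {l : ℝ} (hl : l ≠ 0) :
    Measure.map (fun x : ι → ℝ => fun i => (if i ∈ b then l else 1) * x i) volume
      = ENNReal.ofReal |(l ^ b.card)⁻¹| • (volume : Measure (ι → ℝ)) := by
  have hdet : LinearMap.det (Matrix.toLin' (Matrix.diagonal fun i => if i ∈ b then l else (1 : ℝ))) ≠ 0 := by
    rw [det_partialDil]
    exact pow_ne_zero _ hl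
  rw [partialDil_eq_toLin', Measure.map_linearMap_addHaar_eq_smul_addHaar volume hdet, det_partialDil]

/-! ## §2 Change of variables under block-radial non-collapse, and the averaging -/

omit [Fintype ι] in
/-- the dilates of the shell of a block-homogeneous statistic: `U(D_λ x) ∈ [λa, λb) ↔ U(x) ∈ [a, b)` (`λ > 0`).
[textbook] -/
theorem shell_iff_of_blockHomogeneous {U : (ι → ℝ) → ℝ} (b : Finset ι)
    (hU : ∀ (c : ℝ), 0 < c → ∀ x, U (fun i => (if i ∈ b then c else 1) * x i) = c * U x)
    {l : ℝ} (hl : 0 < l) (a b' : ℝ) (x : ι → ℝ) :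
    (l * a ≤ U (fun i => (if i ∈ b then l else 1) * x i) ∧ U (fun i => (if i ∈ b then l else 1) * x i) < l * b')
      ↔ (a ≤ U x ∧ U x < b') := by
  rw [hU l hl x]
  constructor
  · rintro ⟨h1, h2⟩
    exact ⟨le_of_mul_le_mul_left h1 hl, lt_of_mul_lt_mul_left h2 hl.le⟩
  · rintro ⟨h1, h2⟩
    exact ⟨mul_le_mul_of_nonneg_left h1 hl.le, mul_lt_mul_of_pos_left h2 hl⟩

/-- **CHANGE OF VARIABLES UNDER BLOCK-RADIAL NON-COLLAPSE.**  `g` any measurable density with `g(x) ≤ g(D_λ x)` on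
`S = {a ≤ U < b'}` (`λ > 0`), `U` block-homogeneous ⇒ `∫_S g ≤ λ^{−#b} · ∫_{λa ≤ U < λb'} g`. [textbook] -/
theorem setLIntegral_shell_le_of_blockNonCollapse {g : (ι → ℝ) → ℝ≥0∞} (hg : Measurable g) {U : (ι → ℝ) → ℝ}
    (hUm : Measurable U) (b : Finset ι)
    (hU : ∀ (c : ℝ), 0 < c → ∀ x, U (fun i => (if i ∈ b then c else 1) * x i) = c * U x)
    {l : ℝ} (hl : 0 < l) (a b' : ℝ)
    (hmono : ∀ x, a ≤ U x → U x < b' → g x ≤ g (fun i => (if i ∈ b then l else 1) * x i)) :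
    ∫⁻ x in {x | a ≤ U x ∧ U x < b'}, g x
      ≤ ENNReal.ofReal ((l ^ b.card)⁻¹) * ∫⁻ y in {y | l * a ≤ U y ∧ U y < l * b'}, g y := by
  set S : Set (ι → ℝ) := {x | a ≤ U x ∧ U x < b'} with hS
  set Sl : Set (ι → ℝ) := {y | l * a ≤ U y ∧ U y < l * b'} with hSl
  have hSm : MeasurableSet S := (measurableSet_le measurable_const hUm).inter (measurableSet_lt hUm measurable_const)
  have hSlm : MeasurableSet Sl :=
    (measurableSet_le measurable_const hUm).inter (measurableSet_lt hUm measurable_const)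
  have h1 : ∫⁻ x in S, g x ≤ ∫⁻ x in S, g (fun i => (if i ∈ b then l else 1) * x i) :=
    setLIntegral_mono' hSm fun x hx => hmono x hx.1 hx.2
  refine h1.trans ?_
  have hind : ∀ x : ι → ℝ, S.indicator (fun x => g (fun i => (if i ∈ b then l else 1) * x i)) x
      = Sl.indicator g (fun i => (if i ∈ b then l else 1) * x i) := by
    intro x
    by_cases hx : x ∈ S
    · rw [indicator_of_mem hx, indicator_of_mem]
      exact (shell_iff_of_blockHomogeneous b hU hl a b' x).2 hx
    · rw [indicator_of_notMem hx, indicator_of_notMem]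
      exact fun h => hx ((shell_iff_of_blockHomogeneous b hU hl a b' x).1 h)
  rw [← lintegral_indicator hSm, ← lintegral_indicator hSlm]
  simp_rw [hind]
  rw [← lintegral_map (hg.indicator hSlm) (measurable_partialDil b l), map_volume_partialDil b hl.ne',
    lintegral_smul_measure, abs_of_nonneg (inv_nonneg.2 (pow_nonneg hl.le _)), smul_eq_mul]

/-- **PARTIAL-DILATION AVERAGING.**  `ν = g dx` on `ℝ^ι` (any measurable `g`), `U` measurable and block-homogeneous on
`b`, `0 < a ≤ b'`, `τ < 1`, and block-radial non-collapse `g(x) ≤ g(D_λ x)` for `x` in the shell and `λ ∈ [1−τ, 1]`.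
Then `τ · ν{a ≤ U < b'} ≤ (1−τ)^{−#b} · (b'−a)∕a · ν{(1−τ)a ≤ U < b'}`. [textbook] -/
theorem measure_shell_le_average_block {g : (ι → ℝ) → ℝ≥0∞} (hg : Measurable g) {U : (ι → ℝ) → ℝ}
    (hUm : Measurable U) (b : Finset ι)
    (hU : ∀ (c : ℝ), 0 < c → ∀ x, U (fun i => (if i ∈ b then c else 1) * x i) = c * U x)
    {a b' τ : ℝ} (ha : 0 < a) (hab : a ≤ b') (hτ1 : τ < 1)
    (hmono : ∀ l ∈ Icc (1 - τ) 1, ∀ x, a ≤ U x → U x < b' → g x ≤ g (fun i => (if i ∈ b then l else 1) * x i)) :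
    ENNReal.ofReal τ * volume.withDensity g {x | a ≤ U x ∧ U x < b'}
      ≤ ENNReal.ofReal (((1 - τ) ^ b.card)⁻¹ * ((b' - a) / a))
        * volume.withDensity g {x | (1 - τ) * a ≤ U x ∧ U x < b'} := by
  set S : Set (ι → ℝ) := {x | a ≤ U x ∧ U x < b'} with hSdef
  set P : Set (ι → ℝ) := {x | (1 - τ) * a ≤ U x ∧ U x < b'} with hPdef
  have hS : MeasurableSet S := (measurableSet_le measurable_const hUm).inter (measurableSet_lt hUm measurable_const)
  have hP : MeasurableSet P := (measurableSet_le measurable_const hUm).inter (measurableSet_lt hUm measurable_const)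
  set d := b.card with hd
  rw [withDensity_apply _ hS, withDensity_apply _ hP]
  have hstep : ∀ l ∈ Icc (1 - τ) 1, ∫⁻ x in S, g x
      ≤ ENNReal.ofReal (((1 - τ) ^ d)⁻¹) * ∫⁻ y, {y | l * a ≤ U y ∧ U y < l * b'}.indicator g y := by
    intro l hl
    have hl0 : 0 < l := by linarith [hl.1]
    have h := setLIntegral_shell_le_of_blockNonCollapse hg hUm b hU hl0 a b' (fun x h1 h2 => hmono l hl x h1 h2)
    have hlS : MeasurableSet {y : ι → ℝ | l * a ≤ U y ∧ U y < l * b'} :=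
      (measurableSet_le measurable_const hUm).inter (measurableSet_lt hUm measurable_const)
    rw [← lintegral_indicator hlS] at h
    refine h.trans (mul_le_mul_left (ENNReal.ofReal_le_ofReal ?_) _)
    rw [inv_le_inv₀ (pow_pos hl0 _) (pow_pos (by linarith) _)]
    exact pow_le_pow_left₀ (by linarith) hl.1 _
  have hI : ENNReal.ofReal τ * ∫⁻ x in S, g x = ∫⁻ _ in Icc (1 - τ) (1 : ℝ), ∫⁻ x in S, g x := by
    rw [setLIntegral_const, Real.volume_Icc, mul_comm]
    congr 2
    ring
  rw [hI]
  have hF : Measurable (Function.uncurry fun (l : ℝ) (y : ι → ℝ) =>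
      {y | l * a ≤ U y ∧ U y < l * b'}.indicator g y) := by
    have hset : MeasurableSet {q : ℝ × (ι → ℝ) | q.1 * a ≤ U q.2 ∧ U q.2 < q.1 * b'} :=
      (measurableSet_le (measurable_fst.mul_const a) (hUm.comp measurable_snd)).inter
        (measurableSet_lt (hUm.comp measurable_snd) (measurable_fst.mul_const b'))
    have : (Function.uncurry fun (l : ℝ) (y : ι → ℝ) => {y | l * a ≤ U y ∧ U y < l * b'}.indicator g y)
        = {q : ℝ × (ι → ℝ) | q.1 * a ≤ U q.2 ∧ U q.2 < q.1 * b'}.indicator (g ∘ Prod.snd) := by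
      funext q
      rcases q with ⟨l, y⟩
      by_cases hq : l * a ≤ U y ∧ U y < l * b'
      · rw [Function.uncurry_apply_pair, indicator_of_mem (show y ∈ {y | l * a ≤ U y ∧ U y < l * b'} from hq),
          indicator_of_mem (show (l, y) ∈ {q : ℝ × (ι → ℝ) | q.1 * a ≤ U q.2 ∧ U q.2 < q.1 * b'} from hq)]
        rfl
      · rw [Function.uncurry_apply_pair, indicator_of_notMem (show y ∉ {y | l * a ≤ U y ∧ U y < l * b'} from hq),
          indicator_of_notMem (show (l, y) ∉ {q : ℝ × (ι → ℝ) | q.1 * a ≤ U q.2 ∧ U q.2 < q.1 * b'} from hq)]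
    rw [this]
    exact (hg.comp measurable_snd).indicator hset
  calc ∫⁻ l in Icc (1 - τ) (1 : ℝ), ∫⁻ x in S, g x
      ≤ ∫⁻ l in Icc (1 - τ) (1 : ℝ), ENNReal.ofReal (((1 - τ) ^ d)⁻¹)
          * ∫⁻ y, {y | l * a ≤ U y ∧ U y < l * b'}.indicator g y := setLIntegral_mono' measurableSet_Icc hstep
    _ = ENNReal.ofReal (((1 - τ) ^ d)⁻¹)
          * ∫⁻ l in Icc (1 - τ) (1 : ℝ), ∫⁻ y, {y | l * a ≤ U y ∧ U y < l * b'}.indicator g y := by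
        rw [lintegral_const_mul' _ _ ENNReal.ofReal_ne_top]
    _ = ENNReal.ofReal (((1 - τ) ^ d)⁻¹)
          * ∫⁻ y, ∫⁻ l in Icc (1 - τ) (1 : ℝ), {y | l * a ≤ U y ∧ U y < l * b'}.indicator g y := by
        rw [lintegral_lintegral_swap hF.aemeasurable]
    _ ≤ ENNReal.ofReal (((1 - τ) ^ d)⁻¹) * ∫⁻ y, ENNReal.ofReal ((b' - a) / a) * P.indicator g y := by
        refine mul_le_mul_right (lintegral_mono fun y => ?_) _
        by_cases hyb : U y < b'
        · have hind : ∀ l, {y | l * a ≤ U y ∧ U y < l * b'}.indicator g y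
              = {l : ℝ | l * a ≤ U y ∧ U y < l * b'}.indicator (fun _ => g y) l := by
            intro l
            by_cases h : l * a ≤ U y ∧ U y < l * b'
            · rw [indicator_of_mem (show y ∈ {y | l * a ≤ U y ∧ U y < l * b'} from h),
                indicator_of_mem (show l ∈ {l : ℝ | l * a ≤ U y ∧ U y < l * b'} from h)]
            · rw [indicator_of_notMem (show y ∉ {y | l * a ≤ U y ∧ U y < l * b'} from h),
                indicator_of_notMem (show l ∉ {l : ℝ | l * a ≤ U y ∧ U y < l * b'} from h)]
          have hlset : MeasurableSet {l : ℝ | l * a ≤ U y ∧ U y < l * b'} :=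
            (measurableSet_le (measurable_id.mul_const a) measurable_const).inter
              (measurableSet_lt measurable_const (measurable_id.mul_const b'))
          simp_rw [hind]
          rw [lintegral_indicator hlset, setLIntegral_const, Measure.restrict_apply hlset]
          have hv := volume_params_le (τ := τ) ha hab hyb
          have hset_eq : {l : ℝ | l * a ≤ U y ∧ U y < l * b'} ∩ Icc (1 - τ) 1
              = {l : ℝ | l ∈ Icc (1 - τ) 1 ∧ (l * a ≤ U y ∧ U y < l * b')} := by
            ext l; simp only [mem_inter_iff, mem_setOf_eq]; tauto
          rw [hset_eq, mul_comm]
          refine (mul_le_mul_left hv _).trans (le_of_eq ?_)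
          by_cases hyP : (1 - τ) * a ≤ U y
          · rw [indicator_of_mem (show U y ∈ {u' : ℝ | (1 - τ) * a ≤ u'} from hyP),
              indicator_of_mem (show y ∈ P from ⟨hyP, hyb⟩), Pi.one_apply, mul_one]
          · rw [indicator_of_notMem (show U y ∉ {u' : ℝ | (1 - τ) * a ≤ u'} from hyP),
              indicator_of_notMem (show y ∉ P from fun h => hyP h.1), mul_zero, zero_mul]
        · have hzero : ∀ l ∈ Icc (1 - τ) (1 : ℝ), {y | l * a ≤ U y ∧ U y < l * b'}.indicator g y = 0 := by
            intro l hl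
            refine indicator_of_notMem (fun h => hyb ?_) _
            have hb : 0 < b' := lt_of_lt_of_le ha hab
            calc U y < l * b' := h.2
              _ ≤ 1 * b' := mul_le_mul_of_nonneg_right hl.2 hb.le
              _ = b' := one_mul b'
          rw [setLIntegral_congr_fun measurableSet_Icc hzero, lintegral_zero]
          exact bot_le
    _ = ENNReal.ofReal (((1 - τ) ^ d)⁻¹ * ((b' - a) / a)) * ∫⁻ y in P, g y := by
        rw [lintegral_const_mul _ (hg.indicator hP), lintegral_indicator hP, ← mul_assoc,
          ← ENNReal.ofReal_mul (inv_nonneg.2 (pow_nonneg (by linarith) _))]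

/-! ## §3 The block form of device (α): constant `3(#b+1)∕(1−ρ)` — block dimension only -/

/-- **THE SHELL OF A BLOCK-HOMOGENEOUS STATISTIC UNDER ANY DENSITY.**  `ν = g dx` on `ℝ^ι`, `g` ANY measurable
density (exterior cuts included); `b` a nonempty block; `U` measurable with `U(D_λ x) = λU(x)`; `θ > 0`, `0 < ρ < 1`;
BLOCK-RADIAL NON-COLLAPSE of the full density on the shell, `g(x) ≤ g(D_λ x)` for `θ(1−ρ) ≤ U(x) < θ`,
`λ ∈ [1 − 1∕(#b+1), 1]` (radial monotonicity of the action in the block + the collar condition on the exterior cuts).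
Then `ν{θ(1−ρ) ≤ U < θ} ≤ 3(#b+1)·ρ∕(1−ρ) · ν{U < θ}`. [textbook] -/
theorem measure_shell_le_of_blockHomogeneous {g : (ι → ℝ) → ℝ≥0∞} (hg : Measurable g) {U : (ι → ℝ) → ℝ}
    (hUm : Measurable U) {b : Finset ι} (hb : b.Nonempty)
    (hU : ∀ (c : ℝ), 0 < c → ∀ x, U (fun i => (if i ∈ b then c else 1) * x i) = c * U x)
    {θ ρ : ℝ} (hθ : 0 < θ) (hρ0 : 0 < ρ) (hρ1 : ρ < 1)
    (hmono : ∀ l ∈ Icc (1 - 1 / ((b.card : ℝ) + 1)) 1, ∀ x, θ * (1 - ρ) ≤ U x → U x < θ →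
      g x ≤ g (fun i => (if i ∈ b then l else 1) * x i)) :
    volume.withDensity g {x | θ * (1 - ρ) ≤ U x ∧ U x < θ}
      ≤ ENNReal.ofReal (3 * ((b.card : ℝ) + 1) * (ρ / (1 - ρ))) * volume.withDensity g {x | U x < θ} := by
  set d := b.card with hd
  set τ : ℝ := 1 / ((d : ℝ) + 1) with hτ
  have hd1 : (0 : ℝ) < d + 1 := by positivity
  have hdge : (1 : ℝ) ≤ d := by
    rw [hd]
    exact_mod_cast Finset.card_pos.2 hb
  have hτ0 : 0 < τ := by positivity
  have hτ1 : τ < 1 := by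
    rw [hτ, div_lt_one hd1]
    linarith
  have ha : 0 < θ * (1 - ρ) := mul_pos hθ (by linarith)
  have hab : θ * (1 - ρ) ≤ θ := by nlinarith
  have h := measure_shell_le_average_block hg hUm b hU ha hab hτ1 hmono
  have hτne : ENNReal.ofReal τ ≠ 0 := (ENNReal.ofReal_pos.2 hτ0).ne'
  have hτtop : ENNReal.ofReal τ ≠ ⊤ := ENNReal.ofReal_ne_top
  have hkey : volume.withDensity g {x | θ * (1 - ρ) ≤ U x ∧ U x < θ}
      ≤ (ENNReal.ofReal τ)⁻¹ * (ENNReal.ofReal (((1 - τ) ^ d)⁻¹ * ((θ - θ * (1 - ρ)) / (θ * (1 - ρ))))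
        * volume.withDensity g {x | (1 - τ) * (θ * (1 - ρ)) ≤ U x ∧ U x < θ}) := by
    rw [← ENNReal.mul_le_iff_le_inv hτne hτtop]
    exact h
  refine hkey.trans ?_
  rw [← mul_assoc, ← ENNReal.ofReal_inv_of_pos hτ0, ← ENNReal.ofReal_mul (inv_nonneg.2 hτ0.le)]
  refine mul_le_mul' (ENNReal.ofReal_le_ofReal ?_) (measure_mono fun x hx => hx.2)
  have hfrac : (θ - θ * (1 - ρ)) / (θ * (1 - ρ)) = ρ / (1 - ρ) := by
    field_simp
    ring
  have hinv : τ⁻¹ = (d : ℝ) + 1 := by rw [hτ, one_div, inv_inv]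
  rw [hfrac, hinv]
  have h3 := inv_pow_le_three d
  have hρ' : 0 ≤ ρ / (1 - ρ) := div_nonneg hρ0.le (by linarith)
  calc ((d : ℝ) + 1) * (((1 - τ) ^ d)⁻¹ * (ρ / (1 - ρ)))
      ≤ ((d : ℝ) + 1) * (3 * (ρ / (1 - ρ))) := by
        refine mul_le_mul_of_nonneg_left (mul_le_mul_of_nonneg_right ?_ hρ') hd1.le
        rw [hτ]; exact h3
    _ = 3 * ((d : ℝ) + 1) * (ρ / (1 - ρ)) := by ring

/-- **(M1) ON THE CUT LAW FOR A BLOCK-HOMOGENEOUS STATISTIC — device (α) with exterior variables and all cuts.**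
Under the hypotheses of `measure_shell_le_of_blockHomogeneous`:
`T4ShellMeasure.SlotAntiConcentration (ν|{U < θ}) U θ ρ (3(#b+1)∕(1−ρ))`. [textbook] -/
theorem slotAntiConcentration_restrict_of_blockHomogeneous {g : (ι → ℝ) → ℝ≥0∞} (hg : Measurable g)
    {U : (ι → ℝ) → ℝ} (hUm : Measurable U) {b : Finset ι} (hb : b.Nonempty)
    (hU : ∀ (c : ℝ), 0 < c → ∀ x, U (fun i => (if i ∈ b then c else 1) * x i) = c * U x)
    {θ ρ : ℝ} (hθ : 0 < θ) (hρ0 : 0 < ρ) (hρ1 : ρ < 1)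
    (hmono : ∀ l ∈ Icc (1 - 1 / ((b.card : ℝ) + 1)) 1, ∀ x, θ * (1 - ρ) ≤ U x → U x < θ →
      g x ≤ g (fun i => (if i ∈ b then l else 1) * x i)) :
    SlotAntiConcentration ((volume.withDensity g).restrict {x | U x < θ}) U θ ρ
      (3 * ((b.card : ℝ) + 1) / (1 - ρ)) := by
  unfold SlotAntiConcentration
  have hE : MeasurableSet {x : ι → ℝ | U x < θ} := measurableSet_lt hUm measurable_const
  have hinter : {x : ι → ℝ | θ * (1 - ρ) ≤ U x ∧ U x < θ} ∩ {x | U x < θ}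
      = {x | θ * (1 - ρ) ≤ U x ∧ U x < θ} := inter_eq_left.2 fun x hx => hx.2
  rw [Measure.restrict_apply_univ, Measure.restrict_apply' hE, hinter]
  refine (measure_shell_le_of_blockHomogeneous hg hUm hb hU hθ hρ0 hρ1 hmono).trans (le_of_eq ?_)
  congr 2
  field_simp

end Summit.QuantumFields.YangMills.Theorems.N21PartialDilationHazard
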